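import Summits.ResolutionOfSingularities.ResolutionOfSingularities.Theorems.UltraWalkLaw
import Summits.ResolutionOfSingularities.ResolutionOfSingularities.Theorems.AntelopeDictionary
import HarnessLib

/-!
# UltraWalkInhabitant — the certified classes are INHABITED: a certified forced run of length 1 in characteristic 2

NODE «UltraWalk» (decomp-res lens-3, gen 30), annex.  The Fermat quintic `F = x₀⁵ + x₁⁵ + x₂⁵` over `𝔽₂` at exponent
`q = 2¹`: a ROOT (`fermat_isRoot`: no `2`-power monomials, `ord₀ F = 5 ≥ 2`), of degree `5`, whose top locus is the
origin WITH A CERTIFICATE OF SIZE 4 (`fermatCert`: `D^{(e_l)}F = x_l⁴`, so `1 · x_l⁴ ∈ J_top` with unit cofactors), and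
every point of the exceptional divisor of the first blow-up is equimultiple (`ord₀ F ≥ 2q`, the tree's
`HugValuationCut.isEquimultiplePoint_of_two_mul_le`).  Hence a `4`-certified forced run of length `1` (`fermatRun`) and
**`¬ UnifBoundCert (fun _ => 4) 5 0`** (`not_unifBoundCert_four_five_zero`): the law's bound at `(β ≡ 4, d = 5)` is NOT
the empty bound — the decided cell is not vacuous.  No `sorry`, standard axioms. (Sources: Hauser2010, §F.) [folklore]
-/

noncomputable section

open MvPolynomial
open Literature.AlgebraicGeometry.Resolution
open Literature.AlgebraicGeometry.Resolution.Hauser2010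
open Literature.AlgebraicGeometry.Resolution.PointBlowup
open Summit.ResolutionOfSingularities.ResolutionOfSingularities.Theorems.TightDefectClasses
open Summit.ResolutionOfSingularities.ResolutionOfSingularities.Theorems.HugValuationCut (isEquimultiplePoint_of_two_mul_le)

namespace Summit.ResolutionOfSingularities.ResolutionOfSingularities.Theorems.UltraWalk

/-- The Fermat quintic over `𝔽₂`. DEFINITION (support). [folklore] -/
def fermat5 : MvPolynomial (Fin 3) (ZMod 2) := X 0 ^ 5 + X 1 ^ 5 + X 2 ^ 5

/-- Its coefficients. [folklore] -/
theorem coeff_fermat5 (m : Fin 3 →₀ ℕ) : coeff m fermat5 =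
    (if Finsupp.single 0 5 = m then 1 else 0) + (if Finsupp.single 1 5 = m then 1 else 0) +
      (if Finsupp.single 2 5 = m then 1 else 0) := by
  simp only [fermat5, coeff_add, coeff_X_pow]

/-- The coefficients of degree `< 5` vanish. [folklore] -/
theorem coeff_fermat5_eq_zero {m : Fin 3 →₀ ℕ} (hm : m.degree < 5) : coeff m fermat5 = 0 := by
  have key : ∀ i : Fin 3, Finsupp.single i 5 ≠ m := fun i hi => by
    rw [← hi, Finsupp.degree_single] at hm
    exact lt_irrefl 5 hm
  simp [coeff_fermat5, key]

/-- `ord₀ F ≥ 5`. [folklore] -/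
theorem five_le_ordZero_fermat5 : ((5 : ℕ) : ℕ∞) ≤ ordZero fermat5 :=
  (natCast_le_ordZero_iff 5 fermat5).mpr fun _ hm => coeff_fermat5_eq_zero hm

/-- No monomial of `F` is a `2`-power: deleting the `2`-power monomials does nothing. [folklore] -/
theorem deletePthPowers_fermat5 : deletePthPowers 2 fermat5 = fermat5 := by
  ext m
  rw [coeff_deletePthPowers]
  split_ifs with h
  · have key : ∀ i : Fin 3, Finsupp.single i 5 ≠ m := fun i hi => by
      have h5 := (isPthPowerExponent_iff 2 m).mp h i
      rw [← hi, Finsupp.single_eq_same] at h5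
      omega
    simp [coeff_fermat5, key]
  · rfl

/-- `deg F ≤ 5`. [folklore] -/
theorem totalDegree_fermat5_le : fermat5.totalDegree ≤ 5 := by
  unfold fermat5
  refine (totalDegree_add _ _).trans (max_le ((totalDegree_add _ _).trans (max_le ?_ ?_)) ?_) <;>
    exact (totalDegree_X_pow _ _).le

/-- The start: the Fermat quintic with zero multiplicity vector. DEFINITION (support). [folklore] -/
def fermatState : State (Fin 3) (ZMod 2) := ⟨fermat5, 0⟩

/-- It is a ROOT of exponent `2¹`. [folklore] -/
theorem fermat_isRoot : IsRoot (2 ^ 1) fermatState := by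
  refine ⟨rfl, ?_, ?_⟩
  · change deletePthPowers (2 ^ 1) fermat5 = fermat5
    rw [pow_one]; exact deletePthPowers_fermat5
  · change (((2 ^ 1 : ℕ)) : ℕ∞) ≤ ordZero fermat5
    exact le_trans (by norm_num) five_le_ordZero_fermat5

/-- In characteristic 2 the first Hasse derivative of `x_i⁵` along `x_l` is `x_l⁴` or `0`. [folklore] -/
theorem hasseDeriv_single_one_X_pow_five (l i : Fin 3) :
    hasseDeriv (ZMod 2) (Finsupp.single l 1) (X i ^ 5 : MvPolynomial (Fin 3) (ZMod 2)) = if i = l then X l ^ 4 else 0 := by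
  split_ifs with h
  · subst h
    rw [hasseDeriv_X_pow, Nat.choose_one_right, CharP.cast_eq_mod (MvPolynomial (Fin 3) (ZMod 2)) 2 5]
    norm_num
  · rw [X_pow_eq_monomial, hasseDeriv_monomial_eq_zero_of_not_le]
    intro hle
    have h1 := Finsupp.le_def.mp hle l
    rw [Finsupp.single_eq_same, Finsupp.single_eq_of_ne (Ne.symm h)] at h1
    omega

/-- `D^{(e_l)} F = x_l⁴`. [folklore] -/
theorem hasseDeriv_single_one_fermat5 (l : Fin 3) : hasseDeriv (ZMod 2) (Finsupp.single l 1) fermat5 = X l ^ 4 := by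
  rw [fermat5, map_add, map_add, hasseDeriv_single_one_X_pow_five, hasseDeriv_single_one_X_pow_five,
    hasseDeriv_single_one_X_pow_five]
  fin_cases l <;> simp

/-- **An isolation CERTIFICATE OF SIZE 4** for the Fermat quintic at `q = 2¹`: `N = 4`, `g = 1`, unit cofactor at `e_l`.
[folklore] -/
def fermatCert : CertData (2 ^ 1) 4 fermat5 where
  N := 4
  N_le := le_rfl
  g := 1
  g_deg := by simp
  g_zero := by simp
  h l a := if a = Finsupp.single l 1 then 1 else 0
  h_deg l a := by split_ifs <;> simp
  eq l := by
    have hmem : Finsupp.single l 1 ∈ hasseIndex (Fin 3) (2 ^ 1) :=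
      mem_hasseIndex.mpr ⟨Finsupp.single_ne_zero.mpr one_ne_zero, by rw [Finsupp.degree_single]; norm_num⟩
    simp_rw [ite_mul, one_mul, zero_mul]
    rw [Finset.sum_ite_eq' (hasseIndex (Fin 3) (2 ^ 1)) (Finsupp.single l 1), if_pos hmem, hasseDeriv_single_one_fermat5]

/-- **A 4-CERTIFIED FORCED RUN OF LENGTH 1** from the Fermat quintic: chart `x₀`, point the origin. [folklore] -/
def fermatRun : CertRun (fun _ => 4) (2 ^ 1) fermatState 1 where
  j _ := 0
  b _ _ := 0
  st i := if i = 0 then fermatState else step (2 ^ 1) 0 (fun _ => 0) fermatState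
  st_zero := if_pos rfl
  st_succ i hi := by
    obtain rfl : i = 0 := Nat.lt_one_iff.mp hi
    simp
  onExc _ _ := rfl
  equimult i hi := by
    obtain rfl : i = 0 := Nat.lt_one_iff.mp hi
    rw [if_pos rfl]
    refine isEquimultiplePoint_of_two_mul_le (2 ^ 1) 0 _ rfl fermatState ?_
    change (((2 * 2 ^ 1 : ℕ)) : ℕ∞) ≤ ordZero fermat5
    exact le_trans (by norm_num) five_le_ordZero_fermat5
  isolated i hi := by
    obtain rfl : i = 0 := Nat.lt_one_iff.mp hi
    rw [if_pos rfl]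
    exact isolatedTop_of_cert ⟨fermatCert⟩
  cert i hi := by
    obtain rfl : i = 0 := Nat.lt_one_iff.mp hi
    rw [if_pos rfl]
    exact ⟨fermatCert⟩

/-- **NON-VACUITY of the decided cell**: the certified uniform bound at `β ≡ 4`, `d = 5` is NOT the empty bound `B = 0`
— a 4-certified forced run of length `1` exists (in characteristic `2`, from the Fermat quintic). [folklore] -/
theorem not_unifBoundCert_four_five_zero : ¬ UnifBoundCert (fun _ => 4) 5 0 := fun h =>
  h 2 Nat.prime_two 1 le_rfl (ZMod 2) fermatState fermat_isRoot totalDegree_fermat5_le fermatRun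

/-- Hence the bound produced by the law at `(β ≡ 4, d = 5)` is POSITIVE. [folklore] -/
theorem unifBoundCert_four_five_pos {B : ℕ} (h : UnifBoundCert (fun _ => 4) 5 B) : 1 ≤ B := by
  rcases Nat.eq_zero_or_pos B with rfl | hB
  · exact (not_unifBoundCert_four_five_zero h).elim
  · exact hB

end Summit.ResolutionOfSingularities.ResolutionOfSingularities.Theorems.UltraWalk
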